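import Literature.MathematicalPhysics.QuantumFieldTheory.Balaban1983to89.B11Eq44Concrete
import Literature.MathematicalPhysics.QuantumFieldTheory.Balaban1983to89.B7Eq136ThirdOrder
import Literature.MathematicalPhysics.QuantumFieldTheory.Balaban1983to89.B7Eq136ThirdPolarization

/-!
# `Balaban1983to89.B11Eq56Order3Concrete` — T. Bałaban, *The variational problem and background fields in renormalization group method
for lattice gauge theories*, Commun. Math. Phys. **102** (1985) 277–309 [Balaban1985Variational], (56) p. 286: **«D^{(3)}(A′) = C^{(3)}(LʲηA′) −
2C^{(2)}(LʲηA′, LʲηHC^{(2)}(A′))» FOR THE CONCRETE REMAINDER `C_j(U₀, ·)` OF [4] ON THE `ℤᵈ` CARRIER** — the trilinear «C^{(3)}», its norm `c₃`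
and the quartic Taylor remainder `K₄` that r08's `B11Eq56Expansion.eq56_order3(_fixedPoint)` takes as HYPOTHESES, INSTANTIATED; hence (56) at
order three for the concrete `C_j` with no hypothesis left on it (the sequel of the gen-5 `B11Eq44Concrete.eq56_order2_concrete`)

statement-level skeleton of published theorems with citation tags; proofs where landed; nothing here is a claim about the Yang–Mills mass gap

PDF held: `paper:balaban1985-cmp102-variational-background` (journal page = PDF page + 276); p. 286 [PDF 10] read from the text layer `p0010.txt`
and the render `run/shared/lean/pub/pub-balaban/b2b-balaban-ref1/pages/1985-cmp102-variational-background/…-p010-x2.png`; [4] =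
`paper:balaban1985-cmp98-averaging` pp. 38–40.

CITATION HEADER / WHAT IS REPRODUCED.  Cell `lit-balaban`, Phase-2 proof seat p06 gen 6 = unit `lit-balaban-p06` (TAKING line HOME/STATUS.md
2026-08-21T11:01:20Z; file 3 of the `C_j⁽³⁾` lane after `B7Eq136ThirdOrder` (the slice object `CCovIter3`, its Cauchy bound and the quartic
remainder) and `B7Eq136ThirdPolarization` (the third polarization `D³[C_j(U₀, ins_S ·)(c)](0)`, its symmetry and (149)-type bound)); SKELETON
row **B11.Eq55** ((55)–(56); owner r08, HOME/lit-balaban-r08/ROWS-B11.md: (56) «proved p250185 (`eq56_order2`, `eq56_order3`, …) with expansion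
(136) of [4] as hypotheses: symmetric polarization C2, trilinear C3, Taylor remainders K₃/K₄»; gen 5's `B11Eq44Concrete` discharged the
order-two hypotheses).  THE PRINT, p. 286 [PDF 10]: *«This implies that a power series expansion of D(A′) begins with second order terms. We can
find this expression from Eq. (49) and the expansion (136) [4] of the function C_j: C_j(LʲηA′ − LʲηHD(A′)) = Σ_{n=2}^∞ C_j^{(n)}(LʲηA′ − LʲηH
Σ_{m=2}^∞ D^{(m)}(A′)) = Σ_{n=2}^∞ D^{(n)}(A′), (56) where C_j^{(n)}, D^{(n)} are homogeneous polynomials of n-th order. From Eq. (56) a sequence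
of recursive equations for D^{(n)} follows. It can be solved easily. For example we have on Λ_j  D^{(2)}(A′) = C^{(2)}(LʲηA′), D^{(3)}(A′) =
C^{(3)}(LʲηA′) − 2C^{(2)}(LʲηA′, LʲηHC^{(2)}(A′)), and so on. Here C_j^{(2)}(A′, A″) denotes a symmetric bilinear form obtained by polarization
from the quadratic form C^{(2)}(A′), and C^{(2)}(A′) = C_j^{(2)}(LʲηA′) on Λ_j.»*  [4] p. 39: *«C_k(U₀, A) = C_k^{(2)}(U₀, A) + C_k^{(3)}(U₀, A) +
… . (136)»*.

DICTIONARY (as `B11Eq44Concrete`: tree units of the concrete [4]-files, level `j` rescaled to `ℤᵈ`; print's `LʲηA′` on `Ω_j` ↦ `a ∈ 𝔸^S`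
(sup norm), `S`/`T` finite sets of fine/coarse bonds, `𝒴 := 𝔸^S`, `𝒳 := 𝔸^T`).  `Cmap a = (C_j(U₀, ins_S a)(c))_{c∈T}`, `C2map P Q =
(½·D²[C_j](0)(P)(Q))_c` (gen 5); THIS FILE: **`C3map P Q R := ((3!)⁻¹·D³[C_j(U₀, ins_S ·)(c)](0)(P)(Q)(R))_{c∈T}`** — the trilinear «C^{(3)}»
of (56)/(136) obtained by polarization (its diagonal is `(C_j⁽³⁾(U₀, ins_S a)(c))_c`, `B7Eq136ThirdOrder.CCovIter3`); `H` stays the abstract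
`Hop : 𝔸^T →ₗ[ℂ] 𝔸^S` with `‖HX‖ ≤ B₀‖X‖` of (45)–(46) as in `B13Contraction113`; print's `C₂` of (44)/(135) is `8·C₁·e^{4cα₀}` (local notation
`C₂`); `C₃ = C3Gen d L` of [4] (149).  Regime = that of `B11Eq44Concrete` / `B7Eq136SecondOrder` (a regular background `U₀` with (52) of [4] at
the top level `k`, witness radius `b`, smallness of [4] Props 4/5, levels `j ≤ k`).

WHAT THIS FILE PROVES (kernel, 0 sorry, standard axioms; one definition with body + theorems).
* §1 `C3map` (a genuine `𝔸^S →ₗ[ℂ] 𝔸^S →ₗ[ℂ] 𝔸^S →ₗ[ℂ] 𝔸^T`), `C3map_apply`.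
* §2 **the order-three inputs of (56), CONCRETE**: `C3map_self` (the diagonal is `C_j⁽³⁾`: `C3map a a a = (CCovIter3 L U₀ (ins_S a) j c)_c`,
  `B7Eq136ThirdPolarization.iteratedDeriv_three_CCovIter_ins_slice`), `CCovIter3_ins_smul` (3-homogeneity), `C3map_symm₁₂`/`C3map_symm₂₃`
  (symmetric), **`norm_C3map_le`**
  (`‖C3map P Q R‖ ≤ (4/3)d·C₃(Lʲ)²b⁻¹·‖P‖‖Q‖‖R‖` — the `c₃` of `eq56_order3`, from (149) of [4] twice differentiated,
  `B7Eq136ThirdPolarization.norm_third_fderiv_CCovIter_ins_le'`), **`norm_Cmap_sub_C2map_sub_C3map_le`** (`‖Cmap a − C2map a a − C3map a a a‖ ≤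
  3C₂(Lʲ)²b⁻²‖a‖⁴` on `‖a‖ < b` — the `K₄` Taylor remainder `h4` of `eq56_order3`, `B7Eq136ThirdOrder.norm_CCovIter_sub_two_three_le` componentwise).
* §3 **(56) AT ORDER THREE FOR THE CONCRETE `C_j`**: **`eq56_order3_concrete`** — for a fixed point `X = D(A′)` of `X ↦ C_j(U₀, A′ − HX)` in the
  ball `‖X‖ ≤ 4C₂(Lʲ)²ε²` (regime of `B11Eq44Concrete.exists_unique_fixedPoint_concrete`: `‖A′‖ < ε`, `9C₂(Lʲ)²B₀ε < 1`, `3ε ≤ b`),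
  `‖D(A′) − (C2map A′ A′ + D3 C2map C3map H A′)‖ ≤ K″·‖A′‖⁴` with r08's PRINTED third-order term `D3 C2 C3 H A′ = C3 A′ A′ A′ − 2•C2 A′ (H(C2 A′ A′))`
  and the explicit `K″` of `B11Eq56Expansion.eq56_order3` at `K₃ = 2C₂(Lʲ)²/b`, `K₄ = 3C₂(Lʲ)²/b²`, `c₂ = dC₃(Lʲ)²`, `c₃ = (4/3)dC₃(Lʲ)²/b` —
  `B11Eq56Expansion.eq56_order3_fixedPoint` with EVERY hypothesis on `C_j` DISCHARGED (the case `A′ = 0` by (55)).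
NOT CLAIMED: the operator `H` itself ((45)–(46) = [5] Thm 3.12), «and so on» (orders `n ≥ 4` / convergence of `Σ D^{(n)}`), the side condition
«X = 0 on Λ₀» of (51).  NOT summit progress.
-/

noncomputable section

open scoped BigOperators Topology
open NormedSpace Finset Metric Filter

namespace Literature.MathematicalPhysics.QuantumFieldTheory.Balaban1983to89.B11Eq56Order3Concrete

open B7Prop1Explicit B7Prop1Local B7Prop2Explicit B7Prop3Flat B7Prop4Flat B7Eq92Concrete B7Prop3GeneralLinear
  B7Prop4GeneralLevels B7Prop5GeneralOperators B7Prop5GeneralInduction B7Prop5GeneralLevels B7Ineq149Pairing B7Eq136SecondOrder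
  B7Eq136Expansion B7Eq136ThirdOrder B7Eq136ThirdPolarization B13Contraction113 B11Eq56Expansion B11Eq44Concrete

-- `Site` alone would resolve to the torus sites of `Setup.lean`; re-export the `ℤ^d` sites of `B7Prop1Explicit`.
export B7Prop1Explicit (Site)

variable {d : ℕ}

/-! ## §1 The object: the trilinear «C^{(3)}» of (56) on the concrete carrier -/

section Objects

variable {𝔸 : Type*} [NormedRing 𝔸] [NormedAlgebra ℂ 𝔸] [CompleteSpace 𝔸]
variable (L : ℕ) (U₀ : Site d → Fin d → 𝔸ˣ) (S T : Finset (Site d × Fin d)) (j : ℕ)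

/-- **«C^{(3)}(LʲηA′)», THE TRILINEAR THIRD-ORDER TERM OF (56)/(136), on the concrete carrier**: `C3map P Q R =
((3!)⁻¹·D³[C_j(U₀, ins_S ·)(c)](0)(P)(Q)(R))_{c∈T}`, a trilinear map `𝔸^S × 𝔸^S × 𝔸^S → 𝔸^T` (the third Fréchet derivative at the origin of
each component of `Cmap`, divided by `3!`; «homogeneous polynomials of n-th order» obtained by polarization).
[cite: Balaban1985Variational, (56) p.286] [cite: Balaban1985Averaging, (136) p.39] -/
def C3map : (S → 𝔸) →ₗ[ℂ] (S → 𝔸) →ₗ[ℂ] (S → 𝔸) →ₗ[ℂ] (T → 𝔸) :=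
  LinearMap.mk₂ ℂ
    (fun P Q =>
      { toFun := fun R => fun c : T => ((Nat.factorial 3 : ℕ) : ℂ)⁻¹ •
          fderiv ℂ (fderiv ℂ (fderiv ℂ (fun a' : S → 𝔸 => CCovIter L U₀ (insCfg S a') j c.1.1 c.1.2))) 0 P Q R
        map_add' := fun R₁ R₂ => funext fun c => by
          simp only [map_add, smul_add, Pi.add_apply]
        map_smul' := fun t R => funext fun c => by
          simp only [map_smul, Pi.smul_apply, RingHom.id_apply, smul_comm t] })
    (fun P₁ P₂ Q => LinearMap.ext fun R => funext fun c => by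
      simp only [LinearMap.coe_mk, AddHom.coe_mk, LinearMap.add_apply, Pi.add_apply, map_add,
        _root_.add_apply, smul_add])
    (fun t P Q => LinearMap.ext fun R => funext fun c => by
      simp only [LinearMap.coe_mk, AddHom.coe_mk, LinearMap.smul_apply, Pi.smul_apply, map_smul,
        _root_.smul_apply, smul_comm t])
    (fun P Q₁ Q₂ => LinearMap.ext fun R => funext fun c => by
      simp only [LinearMap.coe_mk, AddHom.coe_mk, LinearMap.add_apply, Pi.add_apply, map_add,
        _root_.add_apply, smul_add])
    (fun t P Q => LinearMap.ext fun R => funext fun c => by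
      simp only [LinearMap.coe_mk, AddHom.coe_mk, LinearMap.smul_apply, Pi.smul_apply, map_smul,
        _root_.smul_apply, smul_comm t])

/-- `C3map` unfolded at a coarse bond. [cite: Balaban1985Variational, (56) p.286] -/
theorem C3map_apply (P Q R : S → 𝔸) (c : T) :
    C3map L U₀ S T j P Q R c = ((Nat.factorial 3 : ℕ) : ℂ)⁻¹ •
      fderiv ℂ (fderiv ℂ (fderiv ℂ (fun a' : S → 𝔸 => CCovIter L U₀ (insCfg S a') j c.1.1 c.1.2))) 0 P Q R := rfl

end Objects

/-! ## §2 The order-three inputs of (56) — `C3`, `c₃`, `K₄` — on the concrete carrier -/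

section Regime

variable {𝔸 : Type*} [NormedRing 𝔸] [NormedAlgebra ℂ 𝔸] [CompleteSpace 𝔸] [NormOneClass 𝔸]

/-- `C₃ ≥ 0`. [folklore] -/
private theorem C3Gen_nonneg' (d L : ℕ) : 0 ≤ C3Gen d L := by
  unfold C3Gen C1ppGen; positivity

variable (L : ℕ) (hL : 2 ≤ L) {G : Subgroup 𝔸ˣ} (hG : AvgClosed d L G) (k : ℕ)
  (U₀ : Site d → Fin d → 𝔸ˣ) (hU₀ : ∀ x κ, U₀ x κ ∈ G) {α₀ : ℝ} (hα : 0 < α₀)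
  (hα3 : C0 d * α₀ ≤ 1 / 3) (hα4 : 4 * α₀ ≤ c2' d L) (h52 : pdev U₀ < α₀ * (((L : ℝ) ^ k)⁻¹) ^ 2)
  {b : ℝ} (hb : 0 < b)
  (hsmall : Real.exp (4 * (800 * ((d : ℝ) + 1) ^ 2 * ((d : ℝ) + 4)) * α₀)
    * (1 + 8 * (131072 * ((d : ℝ) + 1) ^ 2) * ((L : ℝ) ^ k * b)) ≤ 2)
  (hc₃ : 4 * ((L : ℝ) ^ k * b) < c3 d L)
  (h145 : 8 * d * thetaGen d L α₀ * (L : ℝ)⁻¹ ^ 4 ≤ 1)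
  (h155 : (2 * (L : ℝ) - 1) * (L : ℝ)⁻¹ ^ 2 + 2 * d * thetaGen d L α₀ * (L : ℝ)⁻¹ ^ 3
    + 1 / 8 * (1 + 2 * d * thetaGen d L α₀ * (L : ℝ)⁻¹ ^ 2 + 2 * d * C3Gen d L * ((L : ℝ) ^ k * b)) * (L : ℝ)⁻¹ ^ 2 ≤ 1)
  (S T : Finset (Site d × Fin d))

/-- print's `C₂` of (44) = [4] (135) at a general background (`B7Eq123General.prop4_general` (i)): `8·C₁·e^{4cα₀}`. -/
local notation "C₂" => (8 * (131072 * ((d : ℝ) + 1) ^ 2) * Real.exp (4 * (800 * ((d : ℝ) + 1) ^ 2 * ((d : ℝ) + 4)) * α₀))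

omit [NormedAlgebra ℂ 𝔸] [CompleteSpace 𝔸] [NormOneClass 𝔸] in
include hb hc₃ in
/-- the smallness `2Lᵏb ≤ c₃` of `B7Eq136ThirdOrder` from the present `4Lᵏb < c₃`. [folklore] -/
private theorem hc₃_two : 2 * ((L : ℝ) ^ k * b) ≤ c3 d L := by
  have : 0 ≤ (L : ℝ) ^ k * b := by positivity
  linarith

include hL hG hU₀ hα hα3 hα4 h52 hb hsmall hc₃ in
/-- **the diagonal of `C3map` is the third-order term of (136)**: `C3map a a a = (C_j⁽³⁾(U₀, ins_S a)(c))_{c∈T}` («C^{(3)}(LʲηA′)»: the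
`t³`-coefficient `B7Eq136ThirdOrder.CCovIter3` of the slice equals `(3!)⁻¹·D³f(0)(a, a, a)`, `B7Eq136ThirdPolarization.iteratedDeriv_three_CCovIter_ins_slice`).
[cite: Balaban1985Variational, (56) p.286] [cite: Balaban1985Averaging, (136) p.39] -/
theorem C3map_self {j : ℕ} (hj : j ≤ k) (a : S → 𝔸) :
    C3map L U₀ S T j a a a = fun c : T => CCovIter3 L U₀ (insCfg S a) j c.1.1 c.1.2 := by
  funext c
  rw [C3map_apply, CCovIter3_def,
    iteratedDeriv_three_CCovIter_ins_slice L hL hG k U₀ hU₀ hα hα3 hα4 h52 hb hsmall hc₃ S hj c.1.1 c.1.2 a]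

include hL hG hU₀ hα hα3 hα4 h52 hb hsmall hc₃ in
/-- **`C_j⁽³⁾` IS HOMOGENEOUS OF DEGREE THREE** («homogeneous polynomials of n-th order», (56)/(136)):
`C_j⁽³⁾(U₀, ins_S(t·a))(c) = t³·C_j⁽³⁾(U₀, ins_S a)(c)` (trilinearity of the polarization). [cite: Balaban1985Variational, (56) p.286]
[cite: Balaban1985Averaging, (136) p.39] -/
theorem CCovIter3_ins_smul {j : ℕ} (hj : j ≤ k) (z : Site d) (κ : Fin d) (t : ℂ) (a : S → 𝔸) :
    CCovIter3 L U₀ (insCfg S (t • a)) j z κ = t ^ 3 • CCovIter3 L U₀ (insCfg S a) j z κ := by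
  rw [CCovIter3_def, CCovIter3_def,
    iteratedDeriv_three_CCovIter_ins_slice L hL hG k U₀ hU₀ hα hα3 hα4 h52 hb hsmall hc₃ S hj z κ (t • a),
    iteratedDeriv_three_CCovIter_ins_slice L hL hG k U₀ hU₀ hα hα3 hα4 h52 hb hsmall hc₃ S hj z κ a]
  simp only [map_smul, _root_.smul_apply, smul_smul]
  congr 1
  ring

include hL hG hU₀ hα hα3 hα4 h52 hb hsmall hc₃ in
/-- `C3map` is symmetric in its first two slots (`B7Eq136ThirdPolarization.third_fderiv_CCovIter_ins_symm₁₂`).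
[cite: Balaban1985Variational, (56) p.286] -/
theorem C3map_symm₁₂ {j : ℕ} (hj : j ≤ k) (P Q R : S → 𝔸) : C3map L U₀ S T j P Q R = C3map L U₀ S T j Q P R := by
  funext c
  rw [C3map_apply, C3map_apply, third_fderiv_CCovIter_ins_symm₁₂ L hL hG k U₀ hU₀ hα hα3 hα4 h52 hb hsmall hc₃ S hj c.1.1 c.1.2 P Q R]

include hL hG hU₀ hα hα3 hα4 h52 hb hsmall hc₃ in
/-- `C3map` is symmetric in its last two slots (`B7Eq136ThirdPolarization.third_fderiv_CCovIter_ins_symm₂₃`).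
[cite: Balaban1985Variational, (56) p.286] -/
theorem C3map_symm₂₃ {j : ℕ} (hj : j ≤ k) (P Q R : S → 𝔸) : C3map L U₀ S T j P Q R = C3map L U₀ S T j P R Q := by
  funext c
  rw [C3map_apply, C3map_apply, third_fderiv_CCovIter_ins_symm₂₃ L hL hG k U₀ hU₀ hα hα3 hα4 h52 hb hsmall hc₃ S hj c.1.1 c.1.2 P Q R]

include hL hG hU₀ hα hα3 hα4 h52 hb hsmall hc₃ h145 h155 in
/-- **the `c₃`-bound of the trilinear term**: `‖C3map P Q R‖ ≤ (4/3)·d·C₃·(Lʲ)²·b⁻¹·‖P‖·‖Q‖·‖R‖` — (149) of [4] differentiated twice by Cauchy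
estimates (`B7Eq136ThirdPolarization.norm_third_fderiv_CCovIter_ins_le'`: `‖D³f(0)(P)(Q)(R)‖ ≤ 8dC₃(Lʲ)²b⁻¹‖P‖‖Q‖‖R‖`), divided by `3!`,
componentwise in the sup norm of `𝔸^T`. [cite: Balaban1985Variational, (56) p.286] [cite: Balaban1985Averaging, (149) p.40] -/
theorem norm_C3map_le {j : ℕ} (hj : j ≤ k) (P Q R : S → 𝔸) :
    ‖C3map L U₀ S T j P Q R‖ ≤ 4 / 3 * d * (C3Gen d L * ((L : ℝ) ^ j) ^ 2) * b⁻¹ * ‖P‖ * ‖Q‖ * ‖R‖ := by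
  have hC := C3Gen_nonneg' d L
  have h0 : 0 ≤ 4 / 3 * d * (C3Gen d L * ((L : ℝ) ^ j) ^ 2) * b⁻¹ * ‖P‖ * ‖Q‖ * ‖R‖ := by
    have := hb.le
    positivity
  refine (pi_norm_le_iff_of_nonneg h0).2 fun c => ?_
  rw [C3map_apply, norm_smul, norm_inv, Complex.norm_natCast]
  have h1 := norm_third_fderiv_CCovIter_ins_le' L hL hG k U₀ hU₀ hα hα3 hα4 h52 hb hsmall hc₃ h145 h155 S hj c.1.1 c.1.2 P Q R
  have h6 : ((Nat.factorial 3 : ℕ) : ℝ) = 6 := by norm_num [Nat.factorial]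
  rw [h6]
  calc (6 : ℝ)⁻¹ * ‖fderiv ℂ (fderiv ℂ (fderiv ℂ (fun a' : S → 𝔸 => CCovIter L U₀ (insCfg S a') j c.1.1 c.1.2))) 0 P Q R‖
      ≤ 6⁻¹ * (8 * d * (C3Gen d L * ((L : ℝ) ^ j) ^ 2) * b⁻¹ * ‖P‖ * ‖Q‖ * ‖R‖) :=
        mul_le_mul_of_nonneg_left h1 (by norm_num)
    _ = 4 / 3 * d * (C3Gen d L * ((L : ℝ) ^ j) ^ 2) * b⁻¹ * ‖P‖ * ‖Q‖ * ‖R‖ := by ring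

include hL hG hU₀ hα hα3 hα4 h52 hb hsmall hc₃ in
/-- **the `K₄`-bound: after its second- and third-order terms, `Cmap` is quartic**: `‖Cmap a − C2map a a − C3map a a a‖ ≤ 3C₂(Lʲ)²b⁻²·‖a‖⁴` for
`‖a‖ < b` ((136) of [4] beyond third order; `B7Eq136ThirdOrder.norm_CCovIter_sub_two_three_le` componentwise on the slice through `ins_S a`) —
the Taylor-remainder hypothesis `h4` of `B11Eq56Expansion.eq56_order3` with `K₄ = 3C₂(Lʲ)²/b²`, `R = b`.
[cite: Balaban1985Variational, (56) p.286] [cite: Balaban1985Averaging, (136) p.39] -/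
theorem norm_Cmap_sub_C2map_sub_C3map_le {j : ℕ} (hj : j ≤ k) {a : S → 𝔸} (ha : ‖a‖ < b) :
    ‖Cmap L U₀ S T j a - C2map L U₀ S T j a a - C3map L U₀ S T j a a a‖ ≤
      3 * (C₂ * ((L : ℝ) ^ j) ^ 2 * (b ^ 2)⁻¹) * ‖a‖ ^ 4 := by
  have h0 : 0 ≤ 3 * (C₂ * ((L : ℝ) ^ j) ^ 2 * (b ^ 2)⁻¹) * ‖a‖ ^ 4 := by positivity
  by_cases ha0 : a = 0
  · subst ha0
    have hC0 := Cmap_zero L hL hG k U₀ hU₀ hα hα3 hα4 h52 hb hsmall hc₃ S T hj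
    simp [hC0]
  have hβ : 0 < ‖a‖ := norm_pos_iff.mpr ha0
  have hB : ∀ x κ, ‖insCfg S a x κ‖ ≤ ‖a‖ := fun x κ => norm_insCfg_le S a x κ
  rw [C2map_self L hL hG k U₀ hU₀ hα hα3 hα4 h52 hb hsmall hc₃ S T hj a,
    C3map_self L hL hG k U₀ hU₀ hα hα3 hα4 h52 hb hsmall hc₃ S T hj a]
  refine (pi_norm_le_iff_of_nonneg h0).2 fun c => ?_
  rw [Pi.sub_apply, Pi.sub_apply, Cmap_apply]
  exact norm_CCovIter_sub_two_three_le L hL hG k U₀ hU₀ hα hα3 hα4 h52 hb hsmall (hc₃_two L k hb hc₃) hβ hB hj c.1.1 c.1.2 ha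

/-! ## §3 (56) at order three for the concrete `C_j(U₀, ·)` -/

variable (Hop : (T → 𝔸) →ₗ[ℂ] (S → 𝔸)) {B₀ ε : ℝ}

include hL hG hU₀ hα hα3 hα4 h52 hb hsmall hc₃ h145 h155 in
/-- **(56) AT ORDER THREE «D^{(3)}(A′) = C^{(3)}(LʲηA′) − 2C^{(2)}(LʲηA′, LʲηHC^{(2)}(A′))», FOR THE CONCRETE `C_j`, WITH AN EXPLICIT QUARTIC
REMAINDER**: a fixed point `X = D(A′)` of `X ↦ C_j(U₀, A′ − HX)` in the ball `‖X‖ ≤ 4C₂(Lʲ)²ε²` (regime of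
`B11Eq44Concrete.exists_unique_fixedPoint_concrete`: `‖HX‖ ≤ B₀‖X‖`, `‖A′‖ < ε`, `9C₂(Lʲ)²B₀ε < 1`, `3ε ≤ b`) satisfies
`‖D(A′) − (C2map A′ A′ + D3 C2map C3map H A′)‖ ≤ K″·‖A′‖⁴`, where `D3 C2 C3 H A′ = C3 A′ A′ A′ − 2•C2 A′ (H (C2 A′ A′))` is r08's PRINTED third-order
term (`B11Eq56Expansion.D3`) and `K″ = 16K₄ + 28c₃B₀C₂′ + 16c₂B₀²C₂′² + 2c₂B₀(8K₃ + 12c₂B₀C₂′)` with `C₂′ = C₂(Lʲ)²`, `K₃ = 2C₂(Lʲ)²/b`,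
`K₄ = 3C₂(Lʲ)²/b²`, `c₂ = dC₃(Lʲ)²`, `c₃ = (4/3)dC₃(Lʲ)²/b` — `B11Eq56Expansion.eq56_order3_fixedPoint` with every hypothesis on `C_j` DISCHARGED
on the concrete carrier (`quadAnalytic_Cmap`, `C2map_symm`, `norm_C2map_le`, `norm_C3map_le`, `norm_Cmap_sub_C2map_le`,
`norm_Cmap_sub_C2map_sub_C3map_le`; the case `A′ = 0` by (55): then `X = 0`). [cite: Balaban1985Variational, (56) p.286]
[cite: Balaban1985Averaging, (136) p.39, (149) p.40] -/
theorem eq56_order3_concrete {j : ℕ} (hj : j ≤ k) (hB₀ : 0 ≤ B₀) (hHop : ∀ X, ‖Hop X‖ ≤ B₀ * ‖X‖)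
    {A' : S → 𝔸} (hA : ‖A'‖ < ε) (hq : 9 * (C₂ * ((L : ℝ) ^ j) ^ 2) * B₀ * ε < 1) (hε : 3 * ε ≤ b)
    {X : T → 𝔸} (hX : X ∈ closedBall (0 : T → 𝔸) (4 * (C₂ * ((L : ℝ) ^ j) ^ 2) * ε ^ 2))
    (hfix : Cmap L U₀ S T j (A' - Hop X) = X) :
    ‖X - (C2map L U₀ S T j A' A' + D3 (C2map L U₀ S T j) (C3map L U₀ S T j) Hop A')‖ ≤
      (16 * (3 * (C₂ * ((L : ℝ) ^ j) ^ 2 * (b ^ 2)⁻¹))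
        + 28 * (4 / 3 * d * (C3Gen d L * ((L : ℝ) ^ j) ^ 2) * b⁻¹) * B₀ * (C₂ * ((L : ℝ) ^ j) ^ 2)
        + 16 * (d * (C3Gen d L * ((L : ℝ) ^ j) ^ 2)) * B₀ ^ 2 * (C₂ * ((L : ℝ) ^ j) ^ 2) ^ 2
        + 2 * (d * (C3Gen d L * ((L : ℝ) ^ j) ^ 2)) * B₀
          * (8 * (2 * (C₂ * ((L : ℝ) ^ j) ^ 2 * b⁻¹)) + 12 * (d * (C3Gen d L * ((L : ℝ) ^ j) ^ 2)) * B₀ * (C₂ * ((L : ℝ) ^ j) ^ 2)))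
        * ‖A'‖ ^ 4 := by
  have hC := C3Gen_nonneg' d L
  have hK₃ : 0 ≤ 2 * (C₂ * ((L : ℝ) ^ j) ^ 2 * b⁻¹) := by
    have := hb.le
    positivity
  have hK₄ : 0 ≤ 3 * (C₂ * ((L : ℝ) ^ j) ^ 2 * (b ^ 2)⁻¹) := by positivity
  have hc₃' : 0 ≤ 4 / 3 * d * (C3Gen d L * ((L : ℝ) ^ j) ^ 2) * b⁻¹ := by
    have := hb.le
    positivity
  by_cases hA0 : A' = 0
  · -- `A′ = 0`: (55) gives `X = 0`; the printed terms vanish at `0`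
    subst hA0
    have h55 := bound_114_concrete L hL hG k U₀ hU₀ hα hα3 hα4 h52 hb hsmall hc₃ S T Hop hj hB₀ hHop hA hq hε hX hfix
    rw [norm_zero, zero_pow two_ne_zero, mul_zero] at h55
    have hX0 : X = 0 := norm_le_zero_iff.1 h55
    rw [hX0]
    simp [D3_def]
  have hApos : 0 < ‖A'‖ := norm_pos_iff.mpr hA0
  exact eq56_order3_fixedPoint (C2map L U₀ S T j) (C3map L U₀ S T j)
    (quadAnalytic_Cmap L hL hG k U₀ hU₀ hα hα3 hα4 h52 hb hsmall hc₃ S T hj)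
    (fun P Q => C2map_symm L hL hG k U₀ hU₀ hα hα3 hα4 h52 hb hsmall hc₃ S T hj P Q)
    hB₀ (by positivity) (by positivity) hc₃' hK₃ hK₄ hHop
    (fun P Q => norm_C2map_le L hL hG k U₀ hU₀ hα hα3 hα4 h52 hb hsmall hc₃ h145 h155 S T hj P Q)
    (fun P Q R => norm_C3map_le L hL hG k U₀ hU₀ hα hα3 hα4 h52 hb hsmall hc₃ h145 h155 S T hj P Q R)
    (fun Y hY => norm_Cmap_sub_C2map_le L hL hG k U₀ hU₀ hα hα3 hα4 h52 hb hsmall hc₃ S T hj hY)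
    (fun Y hY => norm_Cmap_sub_C2map_sub_C3map_le L hL hG k U₀ hU₀ hα hα3 hα4 h52 hb hsmall hc₃ S T hj hY)
    hApos hA hq hε hX hfix

end Regime

end Literature.MathematicalPhysics.QuantumFieldTheory.Balaban1983to89.B11Eq56Order3Concrete

end
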